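import Literature.Computability.Complexity.ExtMonotoneCircuits
import Literature.Computability.Complexity.ExtMonotoneGRankSupport
import Literature.Computability.Complexity.MonotoneSwitching
import Literature.Computability.Complexity.CliqueTestGraphs
import Literature.Computability.Complexity.CliqueCounting
import Literature.Computability.Complexity.ExtMonotoneCliqueGate
import Summits.PneNP.PneNP.Theorems.CliqueExtLowerBound.Negative.LoadBearing
import Literature.Computability.Complexity.MonotoneSwitchingLeafPairs
import Mathlib

/-!
# Stub `stub_inline` of line `width-threshold-certificate-sparsity` (crux `CliqueExtLowerBound`, stmt-PneNP-10682)

INLINE: Jukna 2012 Thm 9.17 through a {∧₂,∨₂,0,1}-circuit whose leaves carry local DNF ≤ CNF pairs; correcting families charged as events on the two referee families.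

Proof: the two-valued engine `Circuit.exists_pairApproximators`
(`Literature/Computability/Complexity/MonotoneSwitchingLeafPairs.lean`) gives the output pair and global
correcting families `Cf` (exact `s`-clauses, `≤ m^a (r-1)^s`) and `Df` (exact `r`-monomials,
`≤ m^a (s-1)^r`); the positive error set lies in `{x ∈ P : Df x}`, of mass `≤ #Df / k^{4(a+c+2)}`
(`card_filter_evalDNF_cliqueVec_mul_pow_le` with `Q = k`, `k² ≤ m`, every `r`-monomial spanning
`≥ 4(a+c+2)` vertices), the negative one in `{x ∈ N : ¬ Cf x}`, of mass `≤ #Cf / D^s`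
(`card_filter_not_evalCNF_compl_mul_pow_le`, `D = ⌊m^{1/8}⌋₊`). Integer sandwiches `m ≤ k^4`,
`(k-1)^4 < m`, `m < (D+1)^8` and explicit thresholds in `m` finish (`pos_numerics`,
`neg_numerics`).
-/

set_option linter.dupNamespace false

open Literature.Computability.Complexity Filter Finset

namespace Summit.PneNP.PneNP.Theorems.CliqueExtLowerBound.WidthThreshold.Inline

open Summit.PneNP.PneNP.Theorems.CliqueExtLowerBound.Negative (eq_of_edges_subset)

/-! ### Integer sandwiches for `⌈m^{1/4}⌉₊` and `⌊m^{1/8}⌋₊` -/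

/-- `(x^{1/n})^n = x` for `x ≥ 0`, `n ≠ 0`. [folklore] -/
theorem rpow_one_div_natCast_pow {x : ℝ} (hx : 0 ≤ x) {n : ℕ} (hn : n ≠ 0) :
    (x ^ (1 / (n : ℝ))) ^ n = x := by
  rw [one_div]; exact Real.rpow_inv_natCast_pow hx hn

/-- Integer sandwich for `k = ⌈m^{1/4}⌉₊`: `m ≤ k^4`. [folklore] -/
theorem le_ceil_pow_four (m : ℕ) : m ≤ ⌈(m : ℝ) ^ (1 / 4 : ℝ)⌉₊ ^ 4 := by
  have h := Nat.le_ceil ((m : ℝ) ^ (1 / 4 : ℝ))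
  have h4 : ((m : ℝ) ^ (1 / 4 : ℝ)) ^ 4 = m := by
    have := rpow_one_div_natCast_pow (x := (m : ℝ)) (by positivity) (n := 4) (by norm_num)
    norm_num at this; exact this
  have : (m : ℝ) ≤ ((⌈(m : ℝ) ^ (1 / 4 : ℝ)⌉₊ : ℕ) : ℝ) ^ 4 := by
    calc (m : ℝ) = ((m : ℝ) ^ (1 / 4 : ℝ)) ^ 4 := h4.symm
      _ ≤ _ := pow_le_pow_left₀ (by positivity) h 4
  exact_mod_cast this

/-- Integer sandwich for `k = ⌈m^{1/4}⌉₊`: `(k-1)^4 < m` (for `m ≥ 1`). [folklore] -/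
theorem ceil_sub_one_pow_four_lt {m : ℕ} (hm : 1 ≤ m) : (⌈(m : ℝ) ^ (1 / 4 : ℝ)⌉₊ - 1) ^ 4 < m := by
  set k := ⌈(m : ℝ) ^ (1 / 4 : ℝ)⌉₊ with hk
  have hpos : (0 : ℝ) < (m : ℝ) ^ (1 / 4 : ℝ) := Real.rpow_pos_of_pos (by exact_mod_cast hm) _
  have hk1 : 1 ≤ k := Nat.one_le_iff_ne_zero.2 fun h0 => by
    have := Nat.ceil_eq_zero.1 h0; linarith
  have hlt : (k : ℝ) < (m : ℝ) ^ (1 / 4 : ℝ) + 1 := Nat.ceil_lt_add_one hpos.le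
  have h4 : ((m : ℝ) ^ (1 / 4 : ℝ)) ^ 4 = m := by
    have := rpow_one_div_natCast_pow (x := (m : ℝ)) (by positivity) (n := 4) (by norm_num)
    norm_num at this; exact this
  have hsub : ((k - 1 : ℕ) : ℝ) < (m : ℝ) ^ (1 / 4 : ℝ) := by
    rw [Nat.cast_sub hk1]; push_cast; linarith
  have : (((k - 1) ^ 4 : ℕ) : ℝ) < m := by
    calc (((k - 1) ^ 4 : ℕ) : ℝ) = ((k - 1 : ℕ) : ℝ) ^ 4 := by push_cast; ring
      _ < ((m : ℝ) ^ (1 / 4 : ℝ)) ^ 4 := pow_lt_pow_left₀ hsub (by positivity) (by norm_num)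
      _ = m := h4
  exact_mod_cast this

/-- Integer sandwich for `D = ⌊m^{1/8}⌋₊`: `m < (D+1)^8`. [folklore] -/
theorem lt_floor_add_one_pow_eight (m : ℕ) : m < (⌊(m : ℝ) ^ (1 / 8 : ℝ)⌋₊ + 1) ^ 8 := by
  have hlt := Nat.lt_floor_add_one ((m : ℝ) ^ (1 / 8 : ℝ))
  have h8 : ((m : ℝ) ^ (1 / 8 : ℝ)) ^ 8 = m := by
    have := rpow_one_div_natCast_pow (x := (m : ℝ)) (by positivity) (n := 8) (by norm_num)
    norm_num at this; exact this
  have : (m : ℝ) < (((⌊(m : ℝ) ^ (1 / 8 : ℝ)⌋₊ + 1 : ℕ)) : ℝ) ^ 8 := by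
    calc (m : ℝ) = ((m : ℝ) ^ (1 / 8 : ℝ)) ^ 8 := h8.symm
      _ < _ := by
        push_cast
        exact pow_lt_pow_left₀ hlt (by positivity) (by norm_num)
  exact_mod_cast this

/-! ### Explicit numerics of the two error budgets -/

/-- Positive-side budget: `8 m^{c+1} · m^a (s-1)^r ≤ k^{4(a+c+2)}` once `m ≤ k^4` and
`8 (s-1)^r ≤ m`. [folklore] -/
theorem pos_numerics {m k a c r s : ℕ} (hk : m ≤ k ^ 4) (hm : 8 * (s - 1) ^ r ≤ m) :
    8 * m ^ (c + 1) * (m ^ a * (s - 1) ^ r) ≤ k ^ (4 * (a + c + 2)) := by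
  calc 8 * m ^ (c + 1) * (m ^ a * (s - 1) ^ r) = m ^ (a + c + 1) * (8 * (s - 1) ^ r) := by ring
    _ ≤ m ^ (a + c + 1) * m := Nat.mul_le_mul_left _ hm
    _ = m ^ (a + c + 2) := by ring
    _ ≤ (k ^ 4) ^ (a + c + 2) := Nat.pow_le_pow_left hk _
    _ = k ^ (4 * (a + c + 2)) := by rw [← pow_mul]

/-- Negative-side budget: `8 m^{c+1} · m^a (r-1)^s ≤ D^s` once `m < (D+1)^8`, `1 ≤ D`,
`r - 1 ≤ D`, `s ≥ 8(a+c+2)` and `8 · 256^{a+c+2} (r-1)^{8(a+c+2)} ≤ m`. [folklore] -/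
theorem neg_numerics {m D a c r s : ℕ} (hD : m < (D + 1) ^ 8) (hD1 : 1 ≤ D) (hrD : r - 1 ≤ D)
    (hs : 8 * (a + c + 2) ≤ s) (hm : 8 * 256 ^ (a + c + 2) * (r - 1) ^ (8 * (a + c + 2)) ≤ m) :
    8 * m ^ (c + 1) * (m ^ a * (r - 1) ^ s) ≤ D ^ s := by
  set L := a + c + 2 with hL
  have h256 : m ≤ 256 * D ^ 8 := by
    have h1 : (D + 1) ^ 8 ≤ (2 * D) ^ 8 := Nat.pow_le_pow_left (by omega) 8
    have h2 : (2 * D) ^ 8 = 256 * D ^ 8 := by ring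
    omega
  have hmL : m ^ L ≤ 256 ^ L * D ^ (8 * L) := by
    calc m ^ L ≤ (256 * D ^ 8) ^ L := Nat.pow_le_pow_left h256 L
      _ = 256 ^ L * D ^ (8 * L) := by rw [mul_pow, ← pow_mul]
  obtain ⟨e, rfl⟩ : ∃ e, s = 8 * L + e := ⟨s - 8 * L, by omega⟩
  have key : 256 ^ L * (8 * m ^ (c + 1) * (m ^ a * (r - 1) ^ (8 * L))) ≤ 256 ^ L * D ^ (8 * L) := by
    calc 256 ^ L * (8 * m ^ (c + 1) * (m ^ a * (r - 1) ^ (8 * L)))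
        = m ^ (a + c + 1) * (8 * 256 ^ L * (r - 1) ^ (8 * L)) := by ring
      _ ≤ m ^ (a + c + 1) * m := Nat.mul_le_mul_left _ hm
      _ = m ^ L := by rw [hL]; ring
      _ ≤ 256 ^ L * D ^ (8 * L) := hmL
  have key' : 8 * m ^ (c + 1) * (m ^ a * (r - 1) ^ (8 * L)) ≤ D ^ (8 * L) :=
    Nat.le_of_mul_le_mul_left key (Nat.pow_pos (by norm_num))
  calc 8 * m ^ (c + 1) * (m ^ a * (r - 1) ^ (8 * L + e))
      = 8 * m ^ (c + 1) * (m ^ a * (r - 1) ^ (8 * L)) * (r - 1) ^ e := by ring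
    _ ≤ D ^ (8 * L) * D ^ e := Nat.mul_le_mul key' (Nat.pow_le_pow_left hrD e)
    _ = D ^ (8 * L + e) := by rw [← pow_add]

/-- Clearing denominators: `bad · Q ≤ F · fam` and `B · F ≤ Q` with `Q > 0` give `bad · B ≤ fam`.
[folklore] -/
theorem mul_le_of_mul_le_mul {bad fam F Q B : ℕ} (h1 : bad * Q ≤ F * fam) (h2 : B * F ≤ Q)
    (hQ : 0 < Q) : bad * B ≤ fam := by
  refine Nat.le_of_mul_le_mul_right ?_ hQ
  calc bad * B * Q = B * (bad * Q) := by ring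
    _ ≤ B * (F * fam) := Nat.mul_le_mul_left _ h1
    _ = B * F * fam := by ring
    _ ≤ Q * fam := Nat.mul_le_mul_right _ h2
    _ = fam * Q := by ring

/-- From `bad · 8 m^{c+1} ≤ fam` in `ℕ` to the real error budget `ε = 1 / (8 m^{c+1})`. [folklore] -/
theorem cast_le_eps_mul {bad fam m c : ℕ} (hm : 0 < m) (h : bad * (8 * m ^ (c + 1)) ≤ fam) :
    (bad : ℝ) ≤ 1 / (8 * (m : ℝ) ^ (c + 1)) * fam := by
  have hpos : (0 : ℝ) < 8 * (m : ℝ) ^ (c + 1) := by positivity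
  rw [one_div, ← div_eq_inv_mul, le_div_iff₀ hpos]
  exact_mod_cast h

/-! ### Cardinalities of the two referee families -/

/-- `#posGraphs m k = m.choose k` for `k ≥ 2`: clique vectors of distinct `k`-sets differ
(`eq_of_edges_subset`). [folklore] -/
theorem card_posGraphs {m k : ℕ} (hk : 2 ≤ k) : #(posGraphs m k) = m.choose k := by
  rw [posGraphs, Finset.card_image_of_injOn, Finset.card_powersetCard, Finset.card_univ,
    Fintype.card_fin]
  intro T hT T' hT' h
  rw [Finset.mem_coe, Finset.mem_powersetCard] at hT hT'
  refine (eq_of_edges_subset hk hT.2 hT'.2 fun e he => ?_).symm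
  have h1 : cliqueVec T' e = true := by simpa [cliqueVec] using he
  rw [← h] at h1
  simpa [cliqueVec] using h1

/-- Complement vectors `e ↦ [e ∉ M]` of distinct sets differ. [folklore] -/
theorem card_image_complVec {ι : Type*} [Fintype ι] [DecidableEq ι] (S : Finset (Finset ι)) :
    #(S.image fun M => fun e => decide (e ∉ M)) = #S := by
  refine Finset.card_image_of_injective _ fun M M' h => ?_
  ext e
  have := congrFun h e
  simp only [decide_eq_decide] at this
  exact not_iff_not.1 this

open Classical in
/-- **Inline expansion** (registered stub `stub_inline`). [cite: Jukna2012, Thm. 9.17 and Lemma 9.15] -/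
theorem stub_inline : ∀ a c : ℕ, ∃ r₀ s₀ : ℕ, 2 ≤ r₀ ∧ 2 ≤ s₀ ∧ ∀ r s : ℕ, r₀ ≤ r → s₀ ≤ s →
    ∀ᶠ m : ℕ in atTop,
      ∀ (n : ℕ) (Ψ : Circuit (Fin n)), Ψ.IsOver monotoneBasis01 → Ψ.size ≤ m ^ a →
      ∀ (D C : Fin n → Finset (Finset ((⊤ : SimpleGraph (Fin m)).edgeSet))),
        (∀ j, ∀ R ∈ D j, #R ≤ r - 1) → (∀ j, ∀ S ∈ C j, #S ≤ s - 1) →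
        (∀ j x, EvalDNF (D j) x → EvalCNF (C j) x) →
        ∃ dnf cnf : Finset (Finset ((⊤ : SimpleGraph (Fin m)).edgeSet)),
          (∀ R ∈ dnf, #R ≤ r - 1) ∧ (∀ S ∈ cnf, #S ≤ s - 1) ∧
          (∀ x, EvalDNF dnf x → EvalCNF cnf x) ∧
          (#((posGraphs m ⌈(m : ℝ) ^ (1 / 4 : ℝ)⌉₊).filter
              (fun x => Ψ.eval (fun j => decide (EvalDNF (D j) x)) = true ∧ ¬ EvalDNF dnf x)) : ℝ)
            ≤ (1 / (8 * (m : ℝ) ^ (c + 1))) * #(posGraphs m ⌈(m : ℝ) ^ (1 / 4 : ℝ)⌉₊) ∧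
          (#((((powersetCard (Fintype.card ((⊤ : SimpleGraph (Fin m)).edgeSet) / ⌊(m : ℝ) ^ (1 / 8 : ℝ)⌋₊)
          (univ : Finset ((⊤ : SimpleGraph (Fin m)).edgeSet))).image (fun M => fun e => decide (e ∉ M)))).filter
              (fun x => EvalCNF cnf x ∧ Ψ.eval (fun j => decide (EvalCNF (C j) x)) = false)) : ℝ)
            ≤ (1 / (8 * (m : ℝ) ^ (c + 1))) *
              #(((powersetCard (Fintype.card ((⊤ : SimpleGraph (Fin m)).edgeSet) / ⌊(m : ℝ) ^ (1 / 8 : ℝ)⌋₊)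
          (univ : Finset ((⊤ : SimpleGraph (Fin m)).edgeSet))).image (fun M => fun e => decide (e ∉ M)))) := by
  intro a c
  refine ⟨(4 * (a + c + 2)).choose 2 + 2, 8 * (a + c + 2) + 2, by omega, by omega,
    fun r s hr hs => ?_⟩
  filter_upwards [eventually_ge_atTop 17, eventually_ge_atTop (8 * (s - 1) ^ r),
    eventually_ge_atTop (r ^ 8),
    eventually_ge_atTop (8 * 256 ^ (a + c + 2) * (r - 1) ^ (8 * (a + c + 2)))]
    with m hm17 hmP hmr hmN
  intro n Ψ hΨ hsize D C hD hC hDC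
  obtain ⟨dnf, cnf, Cf, Df, hdnf, hcnf, hle, hCf, hDf, hcC, hcD, hlow, hupp⟩ :=
    Circuit.exists_pairApproximators D C (fun x j => decide (EvalCNF (C j) x))
      (fun x j => decide (EvalDNF (D j) x)) hD hC hDC (fun j x hx => decide_eq_true hx)
      (fun j x hx => of_decide_eq_true hx) Ψ hΨ
  refine ⟨dnf, cnf, hdnf, hcnf, hle, ?_, ?_⟩
  · -- positives: the error set lies inside `{x ∈ P : EvalDNF Df x}`
    set k := ⌈(m : ℝ) ^ (1 / 4 : ℝ)⌉₊ with hk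
    have hk4 : m ≤ k ^ 4 := le_ceil_pow_four m
    have hk1 : (k - 1) ^ 4 < m := ceil_sub_one_pow_four_lt (by omega)
    have hk3 : 3 ≤ k := by
      by_contra h
      have : k ^ 4 ≤ 2 ^ 4 := Nat.pow_le_pow_left (by omega) 4
      omega
    have hkk : k * k ≤ m := by
      have h2 : k ≤ (k - 1) * (k - 1) :=
        calc k ≤ 2 * (k - 1) := by omega
          _ ≤ (k - 1) * (k - 1) := Nat.mul_le_mul_right _ (by omega)
      calc k * k ≤ ((k - 1) * (k - 1)) * ((k - 1) * (k - 1)) := Nat.mul_le_mul h2 h2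
        _ = (k - 1) ^ 4 := by ring
        _ ≤ m := hk1.le
    have hP : #(posGraphs m k) = m.choose k := card_posGraphs (by omega)
    have hDf' : ∀ R ∈ Df, (4 * (a + c + 2)).choose 2 < #R := fun R hR => by
      rw [hDf R hR]; omega
    have h1 := card_filter_evalDNF_cliqueVec_mul_pow_le (k := k) (d := 4 * (a + c + 2))
      (by omega : 1 ≤ k) hkk Df hDf'
    have h2 : 8 * m ^ (c + 1) * #Df ≤ k ^ (4 * (a + c + 2)) :=
      calc 8 * m ^ (c + 1) * #Df ≤ 8 * m ^ (c + 1) * (m ^ a * (s - 1) ^ r) :=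
            Nat.mul_le_mul_left _ (hcD.trans (Nat.mul_le_mul_right _ hsize))
        _ ≤ _ := pos_numerics hk4 hmP
    refine cast_le_eps_mul (by omega) (mul_le_of_mul_le_mul ?_ h2 (Nat.pow_pos (by omega)))
    rw [hP]
    refine le_trans (Nat.mul_le_mul_right _ ?_) h1
    calc _ ≤ #(((powersetCard k univ).filter fun K => EvalDNF Df (cliqueVec K)).image cliqueVec) := by
          refine card_le_card fun x hx => ?_
          rw [Finset.mem_filter] at hx
          obtain ⟨K, hK, rfl⟩ := Finset.mem_image.1 hx.1
          exact Finset.mem_image.2 ⟨K, Finset.mem_filter.2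
            ⟨hK, (hupp _ hx.2.1).resolve_left hx.2.2⟩, rfl⟩
      _ ≤ _ := card_image_le
  · -- negatives: the error set lies inside `{x ∈ N : ¬ EvalCNF Cf x}`
    set Dm := ⌊(m : ℝ) ^ (1 / 8 : ℝ)⌋₊ with hDm
    set N₀ := Fintype.card ((⊤ : SimpleGraph (Fin m)).edgeSet) with hN₀
    have hD8 : m < (Dm + 1) ^ 8 := lt_floor_add_one_pow_eight m
    have hrD : r ≤ Dm := by
      by_contra h
      have : (Dm + 1) ^ 8 ≤ r ^ 8 := Nat.pow_le_pow_left (by omega) 8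
      omega
    have hD1 : 1 ≤ Dm := by omega
    have h1 := card_filter_not_evalCNF_compl_mul_pow_le (q := N₀ / Dm) (c := Dm) (v := s) hD1
      (Nat.div_mul_le_self N₀ Dm) Cf hCf
    have hN : #((powersetCard (N₀ / Dm) (univ : Finset ((⊤ : SimpleGraph (Fin m)).edgeSet))).image
        fun M => fun e => decide (e ∉ M)) = N₀.choose (N₀ / Dm) := by
      rw [card_image_complVec, card_powersetCard, card_univ]
    have h2 : 8 * m ^ (c + 1) * #Cf ≤ Dm ^ s :=
      calc 8 * m ^ (c + 1) * #Cf ≤ 8 * m ^ (c + 1) * (m ^ a * (r - 1) ^ s) :=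
            Nat.mul_le_mul_left _ (hcC.trans (Nat.mul_le_mul_right _ hsize))
        _ ≤ _ := neg_numerics hD8 hD1 (by omega) (by omega) hmN
    refine cast_le_eps_mul (by omega) (mul_le_of_mul_le_mul ?_ h2 (Nat.pow_pos hD1))
    rw [hN]
    refine le_trans (Nat.mul_le_mul_right _ ?_) h1
    calc _ ≤ #(((powersetCard (N₀ / Dm) univ).filter fun M =>
            ¬ EvalCNF Cf (fun e => decide (e ∉ M))).image fun M => fun e => decide (e ∉ M)) := by
          refine card_le_card fun x hx => ?_
          rw [Finset.mem_filter] at hx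
          obtain ⟨M, hM, rfl⟩ := Finset.mem_image.1 hx.1
          refine Finset.mem_image.2 ⟨M, Finset.mem_filter.2 ⟨hM, fun hCfx => ?_⟩, rfl⟩
          have := hlow _ hCfx hx.2.1
          rw [hx.2.2] at this
          exact Bool.false_ne_true this
      _ ≤ _ := card_image_le

end Summit.PneNP.PneNP.Theorems.CliqueExtLowerBound.WidthThreshold.Inline
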